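import Summits.RiemannHypothesis.RiemannHypothesis.Theses.SignCone

/-!
# Sketch — crux-ideate (ideator 1, round 1) for `SignCone.OscSingleWindow` (stmt-RiemannHypothesis-18012)

First-lemma signatures of the idea card `erasure-unit-comb-certificate`.
Everything is stated over Mathlib primitives (route CONE NOTE: no `Literature` import needed);
the conclusion of `oscSingleWindow_of_forall` is the route decl BY NAME.

The dual form of the single-window class: the far-field sign constraint `Re F ≥ 0` on
`{log 2 ≤ |u|} \ [T, T + log 2]` dualises to a free nonnegative measure `μ` there, i.e. to an
EFFECTIVE POLAR WEIGHT `ρ = 2cosh(u/2) − μ ≤ 2cosh(u/2)` which must equal `2cosh(u/2)` only on the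
near field `|u| < log 2` and on the window itself. A certificate is `(ρ, c)` with `c ≥ 0` fake node
weights and pointwise nonnegativity of the dual density
`D(τ) = 1 + Re ψ(1/4 + iτ/2) − log π + ρ̂(τ) − Σ_n c_n cos(τ log n)`.
-/

namespace Summit.RiemannHypothesis.RiemannHypothesis.Cruxes.OscSingleWindow.ErasureSketch

open MeasureTheory

noncomputable section

/-- The crux at a FIXED window parameter `T` (the item is this for every `T ≥ 3`, with the window
hypothesis packaged as `∃ T ≥ 3, …`; see `oscSingleWindow_of_forall`). Verbatim binders of the item. -/
def OscSingleWindowAt (T : ℝ) : Prop :=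
  ∀ a : ℝ, 0 < a → ∀ (k : ℕ) (g : Fin k → ℝ → ℂ), (∀ i, (ContDiff ℝ ((⊤ : ℕ∞) : WithTop ℕ∞) (g i) ∧ HasCompactSupport (g i)) ∧ tsupport (g i) ⊆ Set.Icc (-a) a) → let F : ℝ → ℂ := fun t => ∑ i, MeasureTheory.convolution (g i) (fun u => (starRingEnd ℂ) ((g i) (-u))) (ContinuousLinearMap.mul ℂ ℂ) MeasureTheory.MeasureSpace.volume t; (∀ n : ℕ, 2 ≤ n → 0 ≤ (F (Real.log n)).re) → (∀ t : ℝ, Real.log 2 ≤ |t| → (F t).re < 0 → T ≤ |t| ∧ |t| ≤ T + Real.log 2) → (∃ t : ℝ, Real.log 2 ≤ |t| ∧ (F t).re < 0) → let M : ℂ → ℂ := fun s => ∫ u : ℝ, F u * Complex.exp ((s - 1 / 2) * u); -(F 0).re ≤ (M 0 + M 1 + ((1 / (2 * Real.pi) : ℂ) * (∫ t : ℝ, M (1 / 2 + t * Complex.I) * ((Complex.digamma (1 / 4 + t / 2 * Complex.I)).re : ℂ)) - F 0 * (Real.log Real.pi : ℂ))).re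

/-- The item is `∀ T ≥ 3, OscSingleWindowAt T` (pure logic; concludes the route decl by name). -/
theorem oscSingleWindow_of_forall (h : ∀ T : ℝ, 3 ≤ T → OscSingleWindowAt T) :
    Summit.RiemannHypothesis.RiemannHypothesis.Theses.SignCone.OscSingleWindow := by
  intro a ha k g hg F hn hw hosc
  obtain ⟨T, hT, hwin⟩ := hw
  exact h T hT a ha k g hg hn hwin hosc

/-- The dual density of a certificate `(ρ, c)` at frequency `τ`:
`D(τ) = 1 + Re ψ(1/4 + iτ/2) − log π + ∫ ρ(u) cos(τu) du − Σ_{2 ≤ n ≤ N} c_n cos(τ log n)`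
(arch weight + unit slack = `2π ×` Riemann–von Mangoldt zero density `+ 1`). -/
def dualDensity (N : ℕ) (c : ℕ → ℝ) (ρ : ℝ → ℝ) (τ : ℝ) : ℝ :=
  1 + (Complex.digamma (1 / 4 + τ / 2 * Complex.I)).re - Real.log Real.pi
    + (∫ u : ℝ, ρ u * Real.cos (τ * u))
    - ∑ n ∈ Finset.Icc 2 N, c n * Real.cos (τ * Real.log n)

/-- **ERASURE CERTIFICATE at window `T`.** An integrable effective polar weight `ρ ≤ 2cosh(u/2)`
(the defect `2cosh(u/2) − ρ ≥ 0` is the dual measure of the far-field sign constraint, so `ρ` is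
pinned to `2cosh(u/2)` exactly where `Re F` carries no sign: near field and window), nonnegative
fake node weights `c` on `2 ≤ n ≤ N`, and POINTWISE nonnegativity of the dual density. -/
def ErasureCertificate (T : ℝ) : Prop :=
  ∃ (N : ℕ) (c : ℕ → ℝ) (ρ : ℝ → ℝ), (∀ n, 0 ≤ c n) ∧ Integrable ρ ∧
    (∀ u : ℝ, ρ u ≤ 2 * Real.cosh (u / 2)) ∧
    (∀ u : ℝ, (|u| < Real.log 2 ∨ (T ≤ |u| ∧ |u| ≤ T + Real.log 2)) → ρ u = 2 * Real.cosh (u / 2)) ∧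
    ∀ τ : ℝ, 0 ≤ dualDensity N c ρ τ

/-- **First lemma of the line (to be proved; Fubini + inversion `Re F(u) = (1/2π)∫ F̂(τ) cos(τu) dτ`
+ `F̂ ≥ 0` + node signs + far-field sign):** a certificate at `T` proves the crux at `T`, for every
cutoff `a`. Pattern: the landed `signConeOscillatory_upTo_of_fakeWeight_unitSlack` /
`slackFunctional_eq_spectralIntegral` (Theorems/SignConePointwiseIdentity.lean), plus one new term
`∫ Re F · (2cosh(u/2) − ρ) ≥ 0`. -/
def CertificateSuffices : Prop := ∀ T : ℝ, ErasureCertificate T → OscSingleWindowAt T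

/-! ## The explicit unit-comb data (the certificate that the numerics j024905 test) -/

/-- `C^∞` step: `0` for `x ≤ 0`, `1` for `x ≥ 1`. -/
def smoothStep (x : ℝ) : ℝ :=
  if x ≤ 0 then 0 else if 1 ≤ x then 1 else
    Real.exp (-1 / x) / (Real.exp (-1 / x) + Real.exp (-1 / (1 - x)))

/-- Collared window profile in `u = log x`: `1` on `[T, T + log 2]`, `0` off `[T − δ, T + log 2 + δ]`. -/
def eta (T δ u : ℝ) : ℝ :=
  smoothStep ((u - (T - δ)) / δ) * smoothStep ((T + Real.log 2 + δ - u) / δ)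

/-- UNIT fake-von-Mangoldt comb on the collared octave: `c_n = 2 (n^{-1/2} + n^{-3/2}) η(log n)` —
the Riemann sum of the window's polar weight `2cosh(u/2) du = (x^{-1/2} + x^{-3/2}) dx`
("Λ replaced by its mean value 1"). -/
def unitComb (T δ : ℝ) (n : ℕ) : ℝ :=
  2 * ((n : ℝ) ^ (-(1 / 2 : ℝ)) + (n : ℝ) ^ (-(3 / 2 : ℝ))) * eta T δ (Real.log n)

/-- Effective polar weight: full `2cosh(u/2)` on the near field and on the collared window,
ERASED elsewhere in the far field except for a low repair bump `ν` on `[log 2, 5/2]`. -/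
def rhoUnit (T δ : ℝ) (ν : ℝ → ℝ) (u : ℝ) : ℝ :=
  2 * Real.cosh (u / 2) * ((if |u| < Real.log 2 then 1 else 0) + eta T δ |u|) + ν |u|

/-- The explicit certificate at `T` (with collar `δ` and repair bump `ν`): the numerics (kit j024905,
`δ = 3/10`, `ν` a piecewise-linear bump of mass `2∫ν ≈ 2.17` on `[0.72, 2.42]`) give
`min_τ D = +0.63` on `[0, 12]` and `≥ +0.92` on `[12, ∞)` for `T = 3`, complete range. -/
def UnitCombCertificate (T δ : ℝ) (ν : ℝ → ℝ) : Prop :=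
  (∀ u, 0 ≤ ν u) ∧ (∀ u, ν u = 0 ∨ (Real.log 2 ≤ u ∧ u ≤ T - δ)) ∧
  (∀ u, ν u ≤ 2 * Real.cosh (u / 2) * (1 - eta T δ u)) ∧ Integrable ν ∧
  ∀ τ : ℝ, 0 ≤ dualDensity (Nat.ceil (2 * Real.exp (T + δ))) (unitComb T δ) (rhoUnit T δ ν) τ

/-- Packaging (to be proved, bookkeeping): the explicit data are an erasure certificate. -/
def UnitCombIsCertificate : Prop :=
  ∀ T δ : ℝ, ∀ ν : ℝ → ℝ, 0 < δ → δ ≤ 1 / 2 → 3 ≤ T → UnitCombCertificate T δ ν → ErasureCertificate T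

/-- **ALIASING NORMAL FORM (stationary phase; to be proved with explicit error `E`):** off the
low frequencies the dual density of the unit comb is `κ + N̂ + ν̂ − 2 Re[e^{iθ(τ)} Z_T(τ)] + O(E)`
with the ONE-OCTAVE smoothed zeta sum `Z_T(τ) = Σ_k (1 + 2πk/τ) η(log(τ/2πk)) k^{-1/2-iτ}`.
Stated as the phase-free lower bound it implies. -/
def AliasingLowerBound (E : ℝ) : Prop :=
  ∀ T δ : ℝ, 3 ≤ T → 0 < δ → δ ≤ 1 / 2 → ∀ τ : ℝ, 2 * Real.pi * Real.exp (T - δ) ≤ τ →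
    (∫ u : ℝ, 2 * Real.cosh (u / 2) * eta T δ |u| * Real.cos (τ * u))
      - (∑ n ∈ Finset.Icc 2 (Nat.ceil (2 * Real.exp (T + δ))), unitComb T δ n * Real.cos (τ * Real.log n))
    ≥ -2 * ‖∑ k ∈ Finset.Icc 1 (Nat.ceil (τ / (2 * Real.pi * Real.exp (T - δ)))),
          ((1 + 2 * Real.pi * k / τ) * eta T δ (Real.log (τ / (2 * Real.pi * k))) : ℂ) *
            (k : ℂ) ^ (-(1 / 2 : ℂ) - τ * Complex.I)‖ - E

end

end Summit.RiemannHypothesis.RiemannHypothesis.Cruxes.OscSingleWindow.ErasureSketch
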